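import Summits.CriticalPhenomena.PercolationContinuityZ3.Theorems.PercNearOneGluingNoHeavyLowerTailCILRelayNeighboursHolds
import Literature.Probability.Percolation.KozmaNitzanPreFKG
import HarnessLib

/-!
# `NoHeavyLowerTail` (stmt-CriticalPhenomena-4575) — the star transfer (tools)

Support file (prover `prim-gen-induct`, blob-quotient / cumulative-isolation line; `--supports
stmt-CriticalPhenomena-4575`).  No definitions, no named facts, no sorries.  Bookkeeping for
`Theorems.cil_of_starStability` (file `…CILStarTransfer`):

Notation: `μ = prodBernoulli w` on `Fin n`, relays `A`, observer `o ∉ A`, level `j`, `π(v) = {x ∈ A : v ↔ x}`,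
`N = |π(o)|`, `L = {1 ≤ N ≤ j}`, `R_q = {|π(q)| ≤ j}`.  `H`-reachability `x ~' y` means an open path using no
edge at `o` (configuration `ω ∩ {e | o ∉ e}`, i.e. the graph `G − o`), `π'(v)` / `π'(B)` the relays `H`-joined
to `v` / to some vertex of `B`.  The star `σ_B` of `o` (`Literature.….starEvent`, Kozma–Nitzan's `σ_B`) is the
event that the open edges at `o` are exactly those to `B`.

* `CutObserver.measureReal_starEvent_inter_avoid` — `σ_B` is independent of every event read off `ω ∩ {e | o ∉ e}`;
* `CutObserver.exists_avoid_of_reachable_star`, `reachable_of_mem_star` — on `σ_B`, `o ↔ x` iff `x` is `H`-joined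
  to a vertex of `B`; hence `π(o) = π'(B)`, and a vertex `q` is either `H`-joined to `B` (then `π(q) = π(o)`) or
  not (then `π(q) = π'(q)`);
* `CutObserver.star_transfer` — **one star**: if `μ(q ≁' B, 1 ≤ |π'(B)| ≤ j) ≤ μ(q ≁' B, |π'(q)| ≤ j)`
  (set-champion stability of `q` against `B` in `G − o`) then `μ(L ∩ σ_B) ≤ μ(R_q ∩ σ_B)`.
-/

noncomputable section

namespace Summit.CriticalPhenomena.PercolationContinuityZ3.Theorems

open MeasureTheory Set Literature.Probability.LatticeModels Literature.Probability.Percolation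
open scoped Classical BigOperators

variable {n : ℕ}

namespace CutObserver

/-- Filter of the relays `H`-joined to `x`, read as membership in `openConn` (same Finset; the two spellings
elaborate different `Decidable` instances). [folklore] -/
theorem filter_avoid_eq (A : Finset (Fin n)) (o x : Fin n) (ω : BondConfig (Fin n)) :
    (A.filter fun z => (openGraph (ω ∩ {e | o ∉ e})).Reachable x z) =
      (A.filter fun z => ω ∩ {e | o ∉ e} ∈ openConn x z) :=
  Finset.filter_congr fun _ _ => Iff.rfl

/-- Filter of the relays `H`-joined to some vertex of `B`, read as membership in `openConn`. [folklore] -/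
theorem filter_avoid_exists_eq (A B : Finset (Fin n)) (o : Fin n) (ω : BondConfig (Fin n)) :
    (A.filter fun z => ∃ y ∈ B, (openGraph (ω ∩ {e | o ∉ e})).Reachable y z) =
      (A.filter fun z => ∃ y ∈ B, ω ∩ {e | o ∉ e} ∈ openConn y z) :=
  Finset.filter_congr fun _ _ => Iff.rfl

/-- The star event `σ_B` of `o` is determined by the edges at `o`. [folklore] -/
theorem determinedBy_starEvent (o : Fin n) (B : Set (Fin n)) :
    DeterminedBy (starEvent o B) (↑(Finset.univ.filter fun e : Sym2 (Fin n) => o ∈ e) : Set (Sym2 (Fin n))) := by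
  rw [determinedBy_iff]
  intro ω ω' hωω'
  simp only [mem_starEvent_iff]
  refine forall₂_congr fun u _ => ?_
  have hmem : s(o, u) ∈ (↑(Finset.univ.filter fun e : Sym2 (Fin n) => o ∈ e) : Set (Sym2 (Fin n))) := by
    simp
  have := Set.ext_iff.1 hωω' s(o, u)
  simp only [mem_inter_iff, hmem, and_true] at this
  rw [this]

/-- **Independence of the star from the configuration off `o`**: for an event read off `ω ∩ {e | o ∉ e}`,
`μ(σ_B ∩ {ω | P (ω ∩ {e | o ∉ e})}) = μ(σ_B) · μ{ω | P (ω ∩ {e | o ∉ e})}`. [folklore] -/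
theorem measureReal_starEvent_inter_avoid (w : Sym2 (Fin n) → unitInterval) (o : Fin n) (B : Set (Fin n))
    (P : BondConfig (Fin n) → Prop) :
    (prodBernoulli w).real (starEvent o B ∩ {ω | P (ω ∩ {e | o ∉ e})}) =
      (prodBernoulli w).real (starEvent o B) * (prodBernoulli w).real {ω | P (ω ∩ {e | o ∉ e})} := by
  set F : Finset (Sym2 (Fin n)) := Finset.univ.filter fun e : Sym2 (Fin n) => o ∈ e with hF
  set Eo : Finset (Sym2 (Fin n)) := Finset.univ.filter fun e : Sym2 (Fin n) => o ∉ e with hEo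
  have hdisj : Disjoint F Eo := by
    rw [Finset.disjoint_left]
    intro e he he'
    rw [hF, Finset.mem_filter] at he
    rw [hEo, Finset.mem_filter] at he'
    exact he'.2 he.2
  have hdet : DeterminedBy {ω : BondConfig (Fin n) | P (ω ∩ {e | o ∉ e})} (↑Eo : Set (Sym2 (Fin n))) := by
    have h := determinedBy_restrict Eo P
    rw [coe_edgesAvoiding] at h
    rw [hEo, coe_edgesAvoiding]
    exact h
  exact prodBernoulli_real_inter_of_determinedBy_disjoint w hdisj (determinedBy_starEvent o B) hdet
    MeasurableSet.of_discrete MeasurableSet.of_discrete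

/-- On the star `σ_B` (`B` not containing `o`), every vertex joined to `o` is `H`-joined to a vertex of `B`
(cut an open path at its first edge, which is an open edge at `o`, hence leads into `B`). [folklore] -/
theorem exists_avoid_of_reachable_star {ω : BondConfig (Fin n)} {o : Fin n} {B : Set (Fin n)}
    (hσ : ω ∈ starEvent o B) {x : Fin n} (hxo : x ≠ o) (hox : (openGraph ω).Reachable o x) :
    ∃ y ∈ B, (openGraph (ω ∩ {e | o ∉ e})).Reachable y x := by
  obtain ⟨wk⟩ := hox
  set q := wk.bypass with hq
  have hpath : q.IsPath := wk.bypass_isPath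
  cases hq' : q with
  | nil => exact absurd rfl hxo.symm
  | cons hadj q' =>
    rename_i v
    rw [hq'] at hpath
    rw [SimpleGraph.Walk.cons_isPath_iff] at hpath
    rw [openGraph, SimpleGraph.fromEdgeSet_adj] at hadj
    have hvo : v ≠ o := fun h => hadj.2 h.symm
    have hvB : v ∈ B := ((mem_starEvent_iff o B ω).1 hσ v hvo).1 hadj.1
    exact ⟨v, hvB, reachable_avoiding_of_walk q' hpath.2⟩

/-- On the star `σ_B`, a vertex of `B` (other than `o`) is adjacent to `o` in the open graph. [folklore] -/
theorem reachable_of_mem_star {ω : BondConfig (Fin n)} {o : Fin n} {B : Set (Fin n)}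
    (hσ : ω ∈ starEvent o B) {y : Fin n} (hyo : y ≠ o) (hyB : y ∈ B) {x : Fin n}
    (hyx : (openGraph (ω ∩ {e | o ∉ e})).Reachable y x) : (openGraph ω).Reachable o x := by
  have hoy : s(o, y) ∈ ω := ((mem_starEvent_iff o B ω).1 hσ y hyo).2 hyB
  have hadj : (openGraph ω).Adj o y := by
    rw [openGraph, SimpleGraph.fromEdgeSet_adj]; exact ⟨hoy, hyo.symm⟩
  exact hadj.reachable.trans (reachable_mono inter_subset_left hyx)

/-- **Star transfer (one star).**  Let `o ∉ A`, `q ≠ o`, `B` a set of vertices `≠ o`, `σ_B` the star event,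
`L = {1 ≤ N ≤ j}`, `R_q = {|π(q)| ≤ j}`.  If `μ(q ≁' B, 1 ≤ |π'(B)| ≤ j) ≤ μ(q ≁' B, |π'(q)| ≤ j)` (events of
the configuration off `o`), then `μ(L ∩ σ_B) ≤ μ(R_q ∩ σ_B)`. [folklore] -/
theorem star_transfer (w : Sym2 (Fin n) → unitInterval) (A : Finset (Fin n)) (o q : Fin n) (j : ℕ)
    (hoA : o ∉ A) (hqo : q ≠ o) (B : Finset (Fin n)) (hBo : ∀ y ∈ B, y ≠ o)
    (hCS : (prodBernoulli w).real {ω : BondConfig (Fin n) |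
        (∀ y ∈ B, ¬ (openGraph (ω ∩ {e | o ∉ e})).Reachable q y) ∧
          1 ≤ (A.filter fun z => ∃ y ∈ B, (openGraph (ω ∩ {e | o ∉ e})).Reachable y z).card ∧
          (A.filter fun z => ∃ y ∈ B, (openGraph (ω ∩ {e | o ∉ e})).Reachable y z).card ≤ j} ≤
      (prodBernoulli w).real {ω : BondConfig (Fin n) |
        (∀ y ∈ B, ¬ (openGraph (ω ∩ {e | o ∉ e})).Reachable q y) ∧
          (A.filter fun z => (openGraph (ω ∩ {e | o ∉ e})).Reachable q z).card ≤ j}) :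
    (prodBernoulli w).real ({ω : BondConfig (Fin n) |
        1 ≤ (A.filter fun x => ω ∈ openConn o x).card ∧ (A.filter fun x => ω ∈ openConn o x).card ≤ j} ∩
        starEvent o ↑B) ≤
      (prodBernoulli w).real ({ω : BondConfig (Fin n) | (A.filter fun x => ω ∈ openConn q x).card ≤ j} ∩
        starEvent o ↑B) := by
  haveI : IsProbabilityMeasure (prodBernoulli w) := inferInstance
  set μ := prodBernoulli w with hμ
  set R' : BondConfig (Fin n) → Fin n → Fin n → Prop := fun ω x y =>
    (openGraph (ω ∩ {e | o ∉ e})).Reachable x y with hR'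
  set L := {ω : BondConfig (Fin n) |
    1 ≤ (A.filter fun x => ω ∈ openConn o x).card ∧ (A.filter fun x => ω ∈ openConn o x).card ≤ j} with hL
  set Rq := {ω : BondConfig (Fin n) | (A.filter fun x => ω ∈ openConn q x).card ≤ j} with hRq
  set σ := starEvent o (↑B : Set (Fin n)) with hσdef
  set V := {ω : BondConfig (Fin n) | (openGraph ω).Reachable q o} with hV
  -- the two `H`-events, written as events of `ω ∩ {e | o ∉ e}`
  set PL : BondConfig (Fin n) → Prop := fun ξ =>
    (∀ y ∈ B, ¬ (openGraph ξ).Reachable q y) ∧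
      1 ≤ (A.filter fun z => ∃ y ∈ B, (openGraph ξ).Reachable y z).card ∧
      (A.filter fun z => ∃ y ∈ B, (openGraph ξ).Reachable y z).card ≤ j with hPL
  set PR : BondConfig (Fin n) → Prop := fun ξ =>
    (∀ y ∈ B, ¬ (openGraph ξ).Reachable q y) ∧ (A.filter fun z => (openGraph ξ).Reachable q z).card ≤ j
    with hPR
  set CSL := {ω : BondConfig (Fin n) | PL (ω ∩ {e | o ∉ e})} with hCSL
  set CSR := {ω : BondConfig (Fin n) | PR (ω ∩ {e | o ∉ e})} with hCSR
  have hkey : μ.real CSL ≤ μ.real CSR := hCS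
  -- (F3) on σ: π(o) = π'(B)
  have hF3 : ∀ ω ∈ σ, (A.filter fun x => ω ∈ openConn o x) =
      (A.filter fun z => ∃ y ∈ B, R' ω y z) := by
    intro ω hω
    refine Finset.filter_congr fun x hx => ⟨fun h => ?_, fun h => ?_⟩
    · have hxo : x ≠ o := fun h' => hoA (h' ▸ hx)
      obtain ⟨y, hy, hyx⟩ := exists_avoid_of_reachable_star hω hxo h
      exact ⟨y, Finset.mem_coe.1 hy, hyx⟩
    · obtain ⟨y, hy, hyx⟩ := h
      exact reachable_of_mem_star hω (hBo y hy) (Finset.mem_coe.2 hy) hyx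
  -- (F4) off V: π(q) = π'(q) and q ≁' B
  have hF4a : ∀ ω, ω ∉ V → (A.filter fun x => ω ∈ openConn q x) = (A.filter fun z => R' ω q z) := by
    intro ω hVω
    refine Finset.filter_congr fun x _ => ⟨fun h => ?_, fun h => reachable_mono inter_subset_left h⟩
    exact reachable_avoiding_of_not_reachable hVω h
  have hF4b : ∀ ω ∈ σ, ω ∉ V → ∀ y ∈ B, ¬ R' ω q y := by
    intro ω hω hVω y hy hqy
    exact hVω ((reachable_of_mem_star hω (hBo y hy) (Finset.mem_coe.2 hy) hqy.symm).symm)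
  -- (F5) on σ: q ≁' B ⇒ q ≁ o
  have hF5 : ∀ ω ∈ σ, (∀ y ∈ B, ¬ R' ω q y) → ω ∉ V := by
    intro ω hω hny hVω
    obtain ⟨y, hy, hyq⟩ := exists_avoid_of_reachable_star hω hqo (SimpleGraph.Reachable.symm hVω)
    exact hny y (Finset.mem_coe.1 hy) hyq.symm
  -- (a) L ∩ σ ∩ V ⊆ Rq ∩ σ ∩ V
  have ha : L ∩ σ ∩ V ⊆ Rq ∩ σ ∩ V := by
    rintro ω ⟨⟨hLω, hω⟩, hVω⟩
    refine ⟨⟨?_, hω⟩, hVω⟩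
    show (A.filter fun x => ω ∈ openConn q x).card ≤ j
    have heq : (A.filter fun x => ω ∈ openConn q x) = (A.filter fun x => ω ∈ openConn o x) :=
      Finset.filter_congr fun x _ => ⟨fun h => (SimpleGraph.Reachable.symm hVω).trans h, fun h => hVω.trans h⟩
    rw [heq]; exact hLω.2
  -- (b) (L ∩ σ) \ V ⊆ σ ∩ CSL
  have hb : (L ∩ σ) \ V ⊆ σ ∩ CSL := by
    rintro ω ⟨⟨hLω, hω⟩, hVω⟩
    refine ⟨hω, ?_⟩
    show PL (ω ∩ {e | o ∉ e})
    refine ⟨hF4b ω hω hVω, ?_, ?_⟩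
    · have := hLω.1; rw [hF3 ω hω] at this; exact this
    · have := hLω.2; rw [hF3 ω hω] at this; exact this
  -- (c) σ ∩ CSR ⊆ (Rq ∩ σ) \ V
  have hc : σ ∩ CSR ⊆ (Rq ∩ σ) \ V := by
    rintro ω ⟨hω, hRω⟩
    change PR (ω ∩ {e | o ∉ e}) at hRω
    obtain ⟨hny, hcard⟩ := hRω
    have hVω : ω ∉ V := hF5 ω hω hny
    refine ⟨⟨?_, hω⟩, hVω⟩
    show (A.filter fun x => ω ∈ openConn q x).card ≤ j
    rw [hF4a ω hVω]; exact hcard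
  -- (d) independence
  have hdL : μ.real (σ ∩ CSL) = μ.real σ * μ.real CSL := measureReal_starEvent_inter_avoid w o ↑B PL
  have hdR : μ.real (σ ∩ CSR) = μ.real σ * μ.real CSR := measureReal_starEvent_inter_avoid w o ↑B PR
  -- assemble
  have hsplitL := measureReal_inter_add_sdiff (μ := μ) (s := L ∩ σ) (MeasurableSet.of_discrete (s := V))
    (measure_ne_top _ _)
  have hsplitR := measureReal_inter_add_sdiff (μ := μ) (s := Rq ∩ σ) (MeasurableSet.of_discrete (s := V))
    (measure_ne_top _ _)
  have h1 : μ.real (L ∩ σ ∩ V) ≤ μ.real (Rq ∩ σ ∩ V) := measureReal_mono ha (measure_ne_top _ _)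
  have h2 : μ.real ((L ∩ σ) \ V) ≤ μ.real (σ ∩ CSL) := measureReal_mono hb (measure_ne_top _ _)
  have h3 : μ.real (σ ∩ CSL) ≤ μ.real (σ ∩ CSR) := by
    rw [hdL, hdR]
    exact mul_le_mul_of_nonneg_left hkey measureReal_nonneg
  have h4 : μ.real (σ ∩ CSR) ≤ μ.real ((Rq ∩ σ) \ V) := measureReal_mono hc (measure_ne_top _ _)
  calc μ.real (L ∩ σ) = μ.real (L ∩ σ ∩ V) + μ.real ((L ∩ σ) \ V) := hsplitL.symm
    _ ≤ μ.real (Rq ∩ σ ∩ V) + μ.real ((Rq ∩ σ) \ V) := by linarith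
    _ = μ.real (Rq ∩ σ) := hsplitR

end CutObserver

end Summit.CriticalPhenomena.PercolationContinuityZ3.Theorems

end
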